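import Literature.Analysis.Complex.BorelCaratheodoryDeriv
import Literature.Analysis.Complex.HolomorphicLogarithm
import Mathlib
import HarnessLib

/-!
# Corridor transfer, part 1: disc estimates, jets and logarithms

Helper file (part 1 of 2) for route `TcThermcert1`, crux `ThermalStiffnessCeilingU8b10_le_1o8`
(item `stmt-Ventures-26381`), line `Cruxes/ThermalStiffnessCeilingU8b10_le_1o8/Lines/zerofree_corridor.lean`,
registered stub `stub_corridorTransfer` (proved in part 2, `TcThermcert1CorridorTransfer.lean`, as `corridorTransfer`).
This part collects the local complex-analysis tools, all over existing Mathlib / tree declarations: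

* §1 the one-sided Borel–Carathéodory coefficient bound at a general centre `c`
  (`‖h^{(k)}(c)‖ ≤ 2·k!·(M − Re h(c))/R^k` from `Re h ≤ M` on `ball c R`; tree lemma
  `Literature.Analysis.Complex.borelCaratheodory_norm_iteratedDeriv_le_of_ball` translated), and its small-ball
  form `‖h^{(k)}(c)‖ ≤ k!·4ε/ρ^k` from `‖h‖ ≤ ε` on `ball c ρ`;
* §2 the two-radii estimate: `‖h^{(n)}(c)‖ ≤ n!·A/R^n` for all `n` and `‖h‖ ≤ ε` on `ball c (R/4)` give
  `‖h‖ ≤ 4ε·2^N + 2A·2^{−N}` on `closedBall c (R/2)` for every `N` (split the Taylor series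
  `Complex.hasSum_taylorSeries_on_ball` at index `N`);
* §3 matching jets pass to logarithms: `f = exp ∘ ℓ_f`, `g = exp ∘ ℓ_g` near `0`, `g 0 ≠ 0`, `ℓ_f 0 = ℓ_g 0`,
  `f^{(k)}(0) = g^{(k)}(0)` (`k < L`) `⇒ (ℓ_f − ℓ_g)^{(k)}(0) = 0` (`k < L`), by the `analyticOrderAt` calculus
  (`f − g = g·(exp∘h − 1)`);
* §4 the corridor `{z | −η < Re z < b+η, |Im z| < η}` is open and convex, and admissible corridor data
  (`f` holomorphic, zero-free, `‖f‖ ≤ e^M`, real with real part `≥ e^{−M}` on the axis) have a holomorphic logarithm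
  `ℓ` with `Re ℓ ≤ M` and `ℓ(x) = log (f x).re` on the real interval
  (`Literature.Analysis.Complex.exists_differentiableOn_exp_eq_of_starConvex`, `…eqOn_of_exp_eqOn`).

No definitions; all statements proved. [folklore] textbook complex analysis; constants not optimised.
-/

noncomputable section

open Complex Metric Set Filter Topology Finset

namespace Summit.Ventures.CertifiedManyBodySolver.Theorems.TcThermcert1.ZeroFreeCorridor

/-! ## §1 Borel–Carathéodory coefficient bounds at a general centre -/

/-- Borel–Carathéodory coefficient bound at a general centre `c`: `h` holomorphic on `ball c R` with `Re h ≤ M`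
there `⇒ ‖h^{(k)}(c)‖ ≤ 2·k!·(M − Re h(c))/R^k` for `k ≥ 1` (apply the centred tree lemma to `w ↦ −h c + h (w + c)`). -/
theorem norm_iteratedDeriv_le_of_re_le {h : ℂ → ℂ} {c : ℂ} {M R : ℝ} (hR : 0 < R)
    (hh : DifferentiableOn ℂ h (ball c R)) (hre : ∀ z ∈ ball c R, (h z).re ≤ M) {k : ℕ} (hk : 1 ≤ k) :
    ‖iteratedDeriv k h c‖ ≤ 2 * k.factorial * (M - (h c).re) / R ^ k := by
  set F : ℂ → ℂ := fun w => -h c + h (w + c) with hF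
  have hmaps : ∀ w ∈ ball (0 : ℂ) R, w + c ∈ ball c R := by
    intro w hw
    rw [mem_ball, dist_eq_norm] at hw ⊢
    simpa using hw
  have hFd : DifferentiableOn ℂ F (ball 0 R) :=
    (hh.comp ((differentiableOn_id).add_const c) hmaps).const_add (-h c)
  have hFre : ∀ w ∈ ball (0 : ℂ) R, (F w).re ≤ M - (h c).re := by
    intro w hw
    have := hre (w + c) (hmaps w hw)
    simp only [hF, add_re, neg_re]
    linarith
  have hF0 : F 0 = 0 := by simp [hF]
  have hBC := Literature.Analysis.Complex.borelCaratheodory_norm_iteratedDeriv_le_of_ball hR hFd hFre hF0 hk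
  have hder : iteratedDeriv k F 0 = iteratedDeriv k h c := by
    have h1 : iteratedDeriv k F 0 = iteratedDeriv k (fun w => h (w + c)) 0 :=
      congrFun (funext fun x => by rw [hF, iteratedDeriv_const_add hk]) 0
    rw [h1, iteratedDeriv_comp_add_const k h c]
    simp
  rw [hder] at hBC
  exact hBC

/-- Small-ball coefficient bound: `h` holomorphic on `ball c ρ` with `‖h‖ ≤ ε` there
`⇒ ‖h^{(k)}(c)‖ ≤ k!·(4ε)/ρ^k` for every `k` (Borel–Carathéodory with `M = ε`, `−Re h(c) ≤ ε`; `k = 0` directly). -/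
theorem norm_iteratedDeriv_le_of_norm_le {h : ℂ → ℂ} {c : ℂ} {ε ρ : ℝ} (hρ : 0 < ρ)
    (hh : DifferentiableOn ℂ h (ball c ρ)) (hε : ∀ z ∈ ball c ρ, ‖h z‖ ≤ ε) (k : ℕ) :
    ‖iteratedDeriv k h c‖ ≤ k.factorial * (4 * ε) / ρ ^ k := by
  have hc : ‖h c‖ ≤ ε := hε c (mem_ball_self hρ)
  have hε0 : 0 ≤ ε := le_trans (norm_nonneg _) hc
  rcases Nat.eq_zero_or_pos k with rfl | hk
  · simp only [iteratedDeriv_zero, Nat.factorial_zero, Nat.cast_one, one_mul, pow_zero, div_one]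
    linarith
  · have hre : ∀ z ∈ ball c ρ, (h z).re ≤ ε := fun z hz => le_trans (re_le_norm _) (hε z hz)
    have h1 := norm_iteratedDeriv_le_of_re_le hρ hh hre hk
    have h2 : -(h c).re ≤ ε := by
      have := abs_re_le_norm (h c)
      have := neg_abs_le (h c).re
      linarith
    have hfac : (0 : ℝ) < k.factorial := by positivity
    have hρk : (0 : ℝ) < ρ ^ k := pow_pos hρ k
    calc ‖iteratedDeriv k h c‖ ≤ 2 * k.factorial * (ε - (h c).re) / ρ ^ k := h1
      _ ≤ 2 * k.factorial * (2 * ε) / ρ ^ k := by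
          gcongr
          linarith
      _ = k.factorial * (4 * ε) / ρ ^ k := by ring

/-! ## §2 The two-radii estimate from a split Taylor series -/

/-- Split Taylor estimate: if `‖h^{(n)}(c)‖ ≤ n!·A/R^n` for all `n` and `‖h^{(n)}(c)‖ ≤ n!·B/(R/4)^n` for `n < N`,
then `‖h z‖ ≤ B·2^N + 2A·2^{−N}` on `closedBall c (R/2)` (`Complex.hasSum_taylorSeries_on_ball`, split at `N`). -/
theorem norm_le_of_taylor_split {h : ℂ → ℂ} {c z : ℂ} {R A B : ℝ} (hR : 0 < R)
    (hh : DifferentiableOn ℂ h (ball c R)) (hA : 0 ≤ A) (hB : 0 ≤ B)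
    (hbig : ∀ n : ℕ, ‖iteratedDeriv n h c‖ ≤ n.factorial * A / R ^ n) (N : ℕ)
    (hfin : ∀ n : ℕ, n < N → ‖iteratedDeriv n h c‖ ≤ n.factorial * B / (R / 4) ^ n)
    (hz : z ∈ closedBall c (R / 2)) :
    ‖h z‖ ≤ B * 2 ^ N + 2 * A * (1 / 2) ^ N := by
  have hzball : z ∈ ball c R := closedBall_subset_ball (by linarith) hz
  have hT := Complex.hasSum_taylorSeries_on_ball hh hzball
  set t : ℕ → ℂ := fun n => (n.factorial : ℂ)⁻¹ • (z - c) ^ n • iteratedDeriv n h c with ht_def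
  have hzc : ‖z - c‖ ≤ R / 2 := by rwa [mem_closedBall, dist_eq_norm] at hz
  -- generic term bound
  have key : ∀ (n : ℕ) (K ρ : ℝ), 0 < ρ → 0 ≤ K →
      ‖iteratedDeriv n h c‖ ≤ n.factorial * K / ρ ^ n → ‖t n‖ ≤ K * (R / 2 / ρ) ^ n := by
    intro n K ρ hρ hK hb
    have hfac : (0 : ℝ) < n.factorial := by positivity
    have hnorm : ‖t n‖ = (n.factorial : ℝ)⁻¹ * (‖z - c‖ ^ n * ‖iteratedDeriv n h c‖) := by
      simp only [ht_def, smul_eq_mul, norm_mul, norm_inv, Complex.norm_natCast, norm_pow]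
    rw [hnorm]
    calc (n.factorial : ℝ)⁻¹ * (‖z - c‖ ^ n * ‖iteratedDeriv n h c‖)
        ≤ (n.factorial : ℝ)⁻¹ * ((R / 2) ^ n * (n.factorial * K / ρ ^ n)) := by
          apply mul_le_mul_of_nonneg_left _ (inv_nonneg.mpr hfac.le)
          exact mul_le_mul (pow_le_pow_left₀ (norm_nonneg _) hzc n) hb (norm_nonneg _)
            (pow_nonneg (by linarith) n)
      _ = K * (R / 2 / ρ) ^ n := by
          rw [div_pow (R / 2) ρ n]
          field_simp
  have htail : ∀ n : ℕ, ‖t (n + N)‖ ≤ A * (1 / 2 : ℝ) ^ (n + N) := by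
    intro n
    have h1 := key (n + N) A R hR hA (hbig (n + N))
    have h2 : R / 2 / R = 1 / 2 := by field_simp
    rwa [h2] at h1
  have hfinb : ∀ n : ℕ, n < N → ‖t n‖ ≤ B * (2 : ℝ) ^ n := by
    intro n hn
    have h1 := key n B (R / 4) (by positivity) hB (hfin n hn)
    have h2 : R / 2 / (R / 4) = 2 := by field_simp; ring
    rwa [h2] at h1
  have hT' : HasSum (fun n => t (n + N)) (h z - ∑ i ∈ range N, t i) := (hasSum_nat_add_iff' N).mpr hT
  have hgeo : HasSum (fun n : ℕ => A * (1 / 2 : ℝ) ^ (n + N)) (2 * A * (1 / 2) ^ N) := by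
    have h0 := hasSum_geometric_two.mul_left (A * (1 / 2 : ℝ) ^ N)
    have h1 : (fun n : ℕ => A * (1 / 2 : ℝ) ^ (n + N)) = fun i => A * (1 / 2) ^ N * (1 / 2) ^ i := by
      funext i; rw [pow_add]; ring
    rw [h1, show 2 * A * (1 / 2 : ℝ) ^ N = A * (1 / 2) ^ N * 2 by ring]
    exact h0
  have h1 : ‖h z - ∑ i ∈ range N, t i‖ ≤ 2 * A * (1 / 2) ^ N := hT'.norm_le_of_bounded hgeo htail
  have h2 : ‖∑ i ∈ range N, t i‖ ≤ B * 2 ^ N := by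
    calc ‖∑ i ∈ range N, t i‖ ≤ ∑ i ∈ range N, ‖t i‖ := norm_sum_le _ _
      _ ≤ ∑ i ∈ range N, B * (2 : ℝ) ^ i := Finset.sum_le_sum fun i hi => hfinb i (mem_range.mp hi)
      _ = B * ∑ i ∈ range N, (2 : ℝ) ^ i := by rw [Finset.mul_sum]
      _ = B * (2 ^ N - 1) := by
          rw [geom_sum_eq (by norm_num : (2 : ℝ) ≠ 1) N]
          norm_num
      _ ≤ B * 2 ^ N := by nlinarith
  calc ‖h z‖ = ‖(h z - ∑ i ∈ range N, t i) + ∑ i ∈ range N, t i‖ := by rw [sub_add_cancel]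
    _ ≤ ‖h z - ∑ i ∈ range N, t i‖ + ‖∑ i ∈ range N, t i‖ := norm_add_le _ _
    _ ≤ 2 * A * (1 / 2) ^ N + B * 2 ^ N := add_le_add h1 h2
    _ = B * 2 ^ N + 2 * A * (1 / 2) ^ N := by ring

/-- Two-radii estimate: `h` holomorphic on `ball c R`, `‖h^{(n)}(c)‖ ≤ n!·A/R^n` for all `n`, and `‖h‖ ≤ ε` on
`ball c (R/4)` `⇒ ‖h‖ ≤ 4ε·2^N + 2A·2^{−N}` on `closedBall c (R/2)`, for every `N`. -/
theorem norm_le_two_radii {h : ℂ → ℂ} {c z : ℂ} {R A ε : ℝ} (hR : 0 < R)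
    (hh : DifferentiableOn ℂ h (ball c R)) (hA : 0 ≤ A)
    (hbig : ∀ n : ℕ, ‖iteratedDeriv n h c‖ ≤ n.factorial * A / R ^ n)
    (hε : ∀ w ∈ ball c (R / 4), ‖h w‖ ≤ ε) (N : ℕ) (hz : z ∈ closedBall c (R / 2)) :
    ‖h z‖ ≤ 4 * ε * 2 ^ N + 2 * A * (1 / 2) ^ N := by
  have hε0 : 0 ≤ ε := le_trans (norm_nonneg _) (hε c (mem_ball_self (by positivity)))
  have hsmall : ∀ n : ℕ, n < N → ‖iteratedDeriv n h c‖ ≤ n.factorial * (4 * ε) / (R / 4) ^ n :=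
    fun n _ => norm_iteratedDeriv_le_of_norm_le (by positivity)
      (hh.mono (ball_subset_ball (by linarith))) hε n
  exact norm_le_of_taylor_split hR hh hA (by positivity) hbig N hsmall hz

/-! ## §3 Matching jets pass to the logarithms -/

/-- If `f = exp ∘ ℓ_f`, `g = exp ∘ ℓ_g` near `0`, `g 0 ≠ 0`, `ℓ_f 0 = ℓ_g 0` and `f^{(k)}(0) = g^{(k)}(0)` for `k < L`,
then `(ℓ_f − ℓ_g)^{(k)}(0) = 0` for `k < L`: `f − g = g·(exp∘h − 1)` with `h = ℓ_f − ℓ_g`, so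
`ord₀ (f − g) = ord₀ g + ord₀ (exp − 1) · ord₀ h = ord₀ h` (`analyticOrderAt_mul`, `AnalyticAt.analyticOrderAt_comp`). -/
theorem iteratedDeriv_sub_eq_zero_of_jets {f g ℓf ℓg : ℂ → ℂ} {U : Set ℂ} (hU : U ∈ 𝓝 (0 : ℂ))
    (hf : DifferentiableOn ℂ f U) (hg : DifferentiableOn ℂ g U)
    (hℓf : DifferentiableOn ℂ ℓf U) (hℓg : DifferentiableOn ℂ ℓg U)
    (hef : ∀ z ∈ U, exp (ℓf z) = f z) (heg : ∀ z ∈ U, exp (ℓg z) = g z) (hg0 : g 0 ≠ 0)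
    (h0 : ℓf 0 = ℓg 0) {L : ℕ} (hjet : ∀ k : ℕ, k < L → iteratedDeriv k f 0 = iteratedDeriv k g 0) :
    ∀ k : ℕ, k < L → iteratedDeriv k (ℓf - ℓg) 0 = 0 := by
  have hfa : AnalyticAt ℂ f 0 := hf.analyticAt hU
  have hga : AnalyticAt ℂ g 0 := hg.analyticAt hU
  have hha : AnalyticAt ℂ (ℓf - ℓg) 0 := (hℓf.analyticAt hU).sub (hℓg.analyticAt hU)
  have hh0 : (ℓf - ℓg) 0 = 0 := by simp [h0]
  -- (a) `ord₀ (f - g) ≥ L`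
  have h1 : (L : ℕ∞) ≤ analyticOrderAt (f - g) 0 := by
    rw [natCast_le_analyticOrderAt_iff_iteratedDeriv_eq_zero (hfa.sub hga)]
    intro i hi
    rw [iteratedDeriv_sub hfa.contDiffAt hga.contDiffAt, hjet i hi, sub_self]
  -- (b) `f - g = g · (E ∘ h)` near `0`, with `E w = exp w - 1`
  have h2 : (f - g) =ᶠ[𝓝 0] (g * ((fun w => exp w - 1) ∘ (ℓf - ℓg))) := by
    filter_upwards [hU] with z hz
    simp only [Pi.sub_apply, Pi.mul_apply, Function.comp_apply]
    rw [← hef z hz, ← heg z hz, Complex.exp_sub]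
    have hne : exp (ℓg z) ≠ 0 := Complex.exp_ne_zero _
    field_simp
  have hEa : ∀ w : ℂ, AnalyticAt ℂ (fun w => exp w - 1) w := fun w =>
    (Complex.differentiable_exp.sub (differentiable_const (1 : ℂ))).analyticAt w
  have hEord : analyticOrderAt (fun w => exp w - 1) ((ℓf - ℓg) 0) = 1 := by
    rw [hh0]
    apply (hEa 0).analyticOrderAt_eq_one_of_zero_deriv_ne_zero
    · simp
    · have hd : deriv (fun w => exp w - 1) 0 = exp 0 := ((Complex.hasDerivAt_exp 0).sub_const 1).deriv
      rw [hd, Complex.exp_zero]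
      exact one_ne_zero
  have h4 : (fun x => (ℓf - ℓg) x - (ℓf - ℓg) 0) = (ℓf - ℓg) := by
    funext x; rw [hh0, sub_zero]
  have h3 : analyticOrderAt (f - g) 0 = analyticOrderAt (ℓf - ℓg) 0 := by
    rw [analyticOrderAt_congr h2, analyticOrderAt_mul hga ((hEa _).comp hha),
      hga.analyticOrderAt_eq_zero.mpr hg0, zero_add, (hEa _).analyticOrderAt_comp hha, hEord, one_mul, h4]
  rw [h3] at h1
  exact (natCast_le_analyticOrderAt_iff_iteratedDeriv_eq_zero hha).mp h1

/-! ## §4 Holomorphic logarithms on the corridor -/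

/-- The corridor `(−η, b+η) × (−η, η)·i` is open and convex. -/
theorem corridor_isOpen_convex {η b : ℝ} {U : Set ℂ}
    (hU : U = {z : ℂ | -η < z.re ∧ z.re < b + η ∧ |z.im| < η}) : IsOpen U ∧ Convex ℝ U := by
  have hUeq : U = ({z : ℂ | -η < z.re} ∩ {z : ℂ | z.re < b + η}) ∩
      ({z : ℂ | -η < z.im} ∩ {z : ℂ | z.im < η}) := by
    ext z
    simp only [hU, mem_setOf_eq, mem_inter_iff, abs_lt]
    tauto
  rw [hUeq]
  exact ⟨((isOpen_lt continuous_const continuous_re).inter (isOpen_lt continuous_re continuous_const)).inter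
      ((isOpen_lt continuous_const continuous_im).inter (isOpen_lt continuous_im continuous_const)),
    ((convex_halfSpace_re_gt _).inter (convex_halfSpace_re_lt _)).inter
      ((convex_halfSpace_im_gt _).inter (convex_halfSpace_im_lt _))⟩

/-- Holomorphic logarithm of admissible corridor data: `f` holomorphic and zero-free on the corridor `U`,
`‖f‖ ≤ e^M` on `U`, real with real part `≥ e^{−M} > 0` on the axis `⇒ f = exp ∘ ℓ` on `U` with `ℓ` holomorphic,
`Re ℓ ≤ M` on `U`, and `ℓ x = log (f x).re` for real `x ∈ (−η, b+η)` (existence on the convex open `U`: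
`Literature.Analysis.Complex.exists_differentiableOn_exp_eq_of_starConvex`; the axis formula by uniqueness of
continuous logarithms on the interval, `Literature.Analysis.Complex.eqOn_of_exp_eqOn`). -/
theorem exists_log_on_corridor {η b M : ℝ} {f : ℂ → ℂ} {U : Set ℂ}
    (hU : U = {z : ℂ | -η < z.re ∧ z.re < b + η ∧ |z.im| < η}) (hη : 0 < η) (hb : 0 < b)
    (hfd : DifferentiableOn ℂ f U) (hf0 : ∀ z ∈ U, f z ≠ 0) (hfM : ∀ z ∈ U, ‖f z‖ ≤ Real.exp M)
    (hfax : ∀ x : ℝ, -η < x → x < b + η → (f x).im = 0 ∧ Real.exp (-M) ≤ (f x).re) :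
    ∃ ℓ : ℂ → ℂ, DifferentiableOn ℂ ℓ U ∧ (∀ z ∈ U, exp (ℓ z) = f z) ∧ (∀ z ∈ U, (ℓ z).re ≤ M) ∧
      ∀ x : ℝ, -η < x → x < b + η → ℓ x = ((Real.log (f x).re : ℝ) : ℂ) := by
  obtain ⟨hUo, hUc⟩ := corridor_isOpen_convex hU
  have hmem : ∀ x : ℝ, -η < x → x < b + η → (x : ℂ) ∈ U := by
    intro x h1 h2
    rw [hU]
    simp only [mem_setOf_eq, ofReal_re, ofReal_im, abs_zero]
    exact ⟨h1, h2, hη⟩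
  have h0U : (0 : ℂ) ∈ U := by simpa using hmem 0 (by linarith) (by linarith)
  -- positivity and realness on the axis
  have hreal : ∀ x : ℝ, -η < x → x < b + η → 0 < (f x).re ∧ f x = (((f x).re : ℝ) : ℂ) := by
    intro x h1 h2
    obtain ⟨him, hre⟩ := hfax x h1 h2
    refine ⟨lt_of_lt_of_le (Real.exp_pos _) hre, ?_⟩
    apply Complex.ext <;> simp [him]
  have hexplog : ∀ x : ℝ, -η < x → x < b + η → exp ((Real.log (f x).re : ℝ) : ℂ) = f x := by
    intro x h1 h2
    obtain ⟨hpos, heq⟩ := hreal x h1 h2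
    rw [← Complex.ofReal_exp, Real.exp_log hpos]
    exact heq.symm
  have hc₀ : exp ((Real.log (f 0).re : ℝ) : ℂ) = f 0 := by
    simpa using hexplog 0 (by linarith) (by linarith)
  obtain ⟨ℓ, hℓd, hℓ0, hℓe⟩ :=
    Literature.Analysis.Complex.exists_differentiableOn_exp_eq_of_starConvex hUo (hUc.starConvex h0U) h0U
      hfd hf0 hc₀
  refine ⟨ℓ, hℓd, hℓe, ?_, ?_⟩
  · intro z hz
    have h1 : Real.exp (ℓ z).re ≤ Real.exp M := by
      rw [← Complex.norm_exp, hℓe z hz]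
      exact hfM z hz
    exact Real.exp_le_exp.mp h1
  · intro x hx1 hx2
    have hs : IsPreconnected (Ioo (-η) (b + η)) := isPreconnected_Ioo
    have hmaps : MapsTo (fun y : ℝ => (y : ℂ)) (Ioo (-η) (b + η)) U := fun y hy => hmem y hy.1 hy.2
    have hG₁ : ContinuousOn (fun y : ℝ => ℓ y) (Ioo (-η) (b + η)) :=
      hℓd.continuousOn.comp continuous_ofReal.continuousOn hmaps
    have hfre : ContinuousOn (fun y : ℝ => (f y).re) (Ioo (-η) (b + η)) :=
      continuous_re.comp_continuousOn (hfd.continuousOn.comp continuous_ofReal.continuousOn hmaps)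
    have hG₂ : ContinuousOn (fun y : ℝ => ((Real.log (f y).re : ℝ) : ℂ)) (Ioo (-η) (b + η)) :=
      continuous_ofReal.comp_continuousOn (hfre.log fun y hy => (hreal y hy.1 hy.2).1.ne')
    have hx₀ : (0 : ℝ) ∈ Ioo (-η) (b + η) := ⟨by linarith, by linarith⟩
    have heq := Literature.Analysis.Complex.eqOn_of_exp_eqOn hs hG₁ hG₂
      (fun y hy => by
        show exp (ℓ y) = exp ((Real.log (f y).re : ℝ) : ℂ)
        rw [hℓe _ (hmem y hy.1 hy.2), hexplog y hy.1 hy.2])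
      hx₀ (by simpa using hℓ0)
    exact heq ⟨hx1, hx2⟩

end Summit.Ventures.CertifiedManyBodySolver.Theorems.TcThermcert1.ZeroFreeCorridor

end
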